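import Summits.QuantumFields.BalabanUV.Beta.SymAveragingHessianCountsBounds

/-!
# `BalabanUV.Beta.SymAveragingHessianCounts` — TABLES-SYM step S2a (an1 gen 41), PART 3∕3 (the intended module name)

This file is one of THREE parts of an1's single scratch module `SymAveragingHessianCounts.lean` (sha16 05392941d6166f37, 1001 l.; COURIER ASK
journal [AN1-G41-S2A] ∕ RE-OFFER [AN1-G42-ONLINE]), split MECHANICALLY at its own section boundaries because the gate's `lint.size` caps files at
400 lines; the namespace spans the three files; every declaration is byte-identical to an1's and in the original order (courier:
b2b-balaban-beta-d1-formalise-leaf-02 gen 12, script `split_s2a.py`).  The FULL header (honest framing, WHY, WHAT, NOT HERE, ABSOLUTE RULE,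
provenance, bib locators) is in part 1 `SymAveragingHessianCountsWords.lean` and applies verbatim to this part.  CONTENT OF THIS PART: §7 the real kernels, §8 packing (`symVhSAt`, `symHessFFAt`, the letters (LV)(TV)(LH)(TH)(V-ff0), (LM)(TM)), §9 decided toy entries.
HONEST (verbatim from part 1): [folklore] letter-list algebra and box sums on `ℤ^d`; 0 sorry, 0 `def … : Prop`, nothing cited as a fact;
NOT D1, NOT BetaPertH, NOT continuum, NOT Clay.  HONEST DEPENDENCY: continuum YM on T⁴ ⇐ BetaPertH ∧ nine spine estimates (0/9 proved);
BetaPertH ⇐ (D1) ∧ (D4) ∧ CAP+tail; G-an2-4 gates asym, D1 and NE2/3/4.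
-/

namespace Summit.QuantumFields.BalabanUV.Beta.SymAveragingHessianCounts

open Finset
open scoped BigOperators Nat
open Literature.MathematicalPhysics.QuantumFieldTheory.Balaban1983to89.Beta
open Literature.MathematicalPhysics.QuantumFieldTheory.Balaban1983to89.Beta.AffineAveraging
open Literature.MathematicalPhysics.QuantumFieldTheory.Balaban1983to89.Beta.AveragingContours
open Literature.MathematicalPhysics.QuantumFieldTheory.Balaban1983to89.Beta.AveragingContoursRooted
open Literature.MathematicalPhysics.QuantumFieldTheory.Balaban1983to89.Beta.TransportedContourVariables
open Literature.MathematicalPhysics.QuantumFieldTheory.Balaban1983to89.Beta.AveragingHessianKernels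
open Literature.MathematicalPhysics.QuantumFieldTheory.Balaban1983to89.Beta.AveragingHessianKernelsRooted
open Summit.QuantumFields.BalabanUV.Beta.KernelPermutation (psite psite_apply psite_symm_apply psite_add psite_sub psite_smul)
open Summit.QuantumFields.BalabanUV.Beta.ResolventPermutation (P1 P1_apply psite_unitVec sum_box_psite toSite_psite psite_block psite_mem_box)
open Summit.QuantumFields.BalabanUV.Beta.SymmetrisedAxialPotential (axialPerm symAxial symLinAvgAt card_perm_fin psite_symm_add
  psite_symm_smul psite_symm_unitVec)

variable {d : ℕ}

/-! ## §7 The real kernels `q¹_sym = LIN∕(d!·L^d)`, `h_sym = HESS∕(2(d!)²L^d)`, `m_sym = VH∕(2(d!)²L^{2d})` -/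

section RealKernels

/-- [our object] `q¹,ρ_sym(f)` — the (0.4) MEAN linear count per block point. -/
noncomputable def symLinKerAt (ρ : Site d) (L : ℕ) (μ : Fin d) (y : Site d) (f : Bond d) : ℝ :=
  (symLinCountAt ρ L μ y f : ℝ) / ((d ! : ℝ) * (L : ℝ) ^ d)

/-- [our object] `h^ρ_sym(f, f′)`. -/
noncomputable def symHessKerAt (ρ : Site d) (L : ℕ) (μ : Fin d) (y : Site d) (f f' : Bond d) : ℝ :=
  (symHessCountAt ρ L μ y f f' : ℝ) / (2 * (d ! : ℝ) ^ 2 * (L : ℝ) ^ d)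

/-- [our object] `m^ρ_sym(f, f′)` (product chart). -/
noncomputable def symVhKerAt (ρ : Site d) (L : ℕ) (μ : Fin d) (y : Site d) (f f' : Bond d) : ℝ :=
  (symVhCountAt ρ L μ y f f' : ℝ) / (2 * (d ! : ℝ) ^ 2 * (L : ℝ) ^ (2 * d))

/-- [folklore] ANTISYMMETRY of `symHessKerAt`. -/
theorem symHessKerAt_swap (ρ : Site d) (L : ℕ) (μ : Fin d) (y : Site d) (f f' : Bond d) :
    symHessKerAt ρ L μ y f' f = -symHessKerAt ρ L μ y f f' := by
  rw [symHessKerAt, symHessKerAt, symHessCountAt_swap, Int.cast_neg, neg_div]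

/-- [folklore] `symHessKerAt` vanishes when the first bond is off the support box (box root). -/
theorem symHessKerAt_eq_zero_left {L : ℕ} {μ : Fin d} {y : Site d} {r : Fin d → ℕ} (hr : r ∈ box d L)
    {f : Bond d} (h : ¬ Near L y f.2) (f' : Bond d) : symHessKerAt (toSite r) L μ y f f' = 0 := by
  rw [symHessKerAt, symHessCountAt_eq_zero_left hr h, Int.cast_zero, zero_div]

/-- [folklore] `symHessKerAt` vanishes when the second bond is off the support box (box root). -/
theorem symHessKerAt_eq_zero_right {L : ℕ} {μ : Fin d} {y : Site d} {r : Fin d → ℕ} (hr : r ∈ box d L)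
    (f : Bond d) {f' : Bond d} (h : ¬ Near L y f'.2) : symHessKerAt (toSite r) L μ y f f' = 0 := by
  rw [symHessKerAt, symHessCountAt_eq_zero_right hr f h, Int.cast_zero, zero_div]

/-- [folklore] `symVhKerAt` vanishes when the first bond is off the support box (box root). -/
theorem symVhKerAt_eq_zero_left {L : ℕ} {μ : Fin d} {y : Site d} {r : Fin d → ℕ} (hr : r ∈ box d L)
    {f : Bond d} (h : ¬ Near L y f.2) (f' : Bond d) : symVhKerAt (toSite r) L μ y f f' = 0 := by
  rw [symVhKerAt, symVhCountAt_eq_zero_left hr h, Int.cast_zero, zero_div]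

/-- [folklore] `symVhKerAt` vanishes when the second bond is off the support box (box root). -/
theorem symVhKerAt_eq_zero_right {L : ℕ} {μ : Fin d} {y : Site d} {r : Fin d → ℕ} (hr : r ∈ box d L)
    (f : Bond d) {f' : Bond d} (h : ¬ Near L y f'.2) : symVhKerAt (toSite r) L μ y f f' = 0 := by
  rw [symVhKerAt, symVhCountAt_eq_zero_right hr f h, Int.cast_zero, zero_div]

/-- [folklore] `symLinKerAt` vanishes off the support box (box root). -/
theorem symLinKerAt_eq_zero {L : ℕ} {μ : Fin d} {y : Site d} {r : Fin d → ℕ} (hr : r ∈ box d L) {f : Bond d}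
    (h : ¬ Near L y f.2) : symLinKerAt (toSite r) L μ y f = 0 := by
  rw [symLinKerAt, symLinCountAt_eq_zero hr h, Int.cast_zero, zero_div]

/-- [folklore] Block-translation covariance of `symHessKerAt`. -/
theorem symHessKerAt_add (ρ : Site d) (L : ℕ) (μ : Fin d) (y t : Site d) (f f' : Bond d) :
    symHessKerAt ρ L μ (y + t) (f.sh ((L : ℤ) • t)) (f'.sh ((L : ℤ) • t)) = symHessKerAt ρ L μ y f f' := by
  rw [symHessKerAt, symHessKerAt, symHessCountAt_add]

/-- [folklore] Block-translation covariance of `symVhKerAt`. -/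
theorem symVhKerAt_add (ρ : Site d) (L : ℕ) (μ : Fin d) (y t : Site d) (f f' : Bond d) :
    symVhKerAt ρ L μ (y + t) (f.sh ((L : ℤ) • t)) (f'.sh ((L : ℤ) • t)) = symVhKerAt ρ L μ y f f' := by
  rw [symVhKerAt, symVhKerAt, symVhCountAt_add]

/-- [folklore] Block-translation covariance of `symLinKerAt`. -/
theorem symLinKerAt_add (ρ : Site d) (L : ℕ) (μ : Fin d) (y t : Site d) (f : Bond d) :
    symLinKerAt ρ L μ (y + t) (f.sh ((L : ℤ) • t)) = symLinKerAt ρ L μ y f := by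
  rw [symLinKerAt, symLinKerAt, symLinCountAt_add]

/-- [folklore] `|h^ρ_sym| ≤ 2ℓ²` (box root) — the SAME constant as the comb's `abs_hessKerAt_le`. -/
theorem abs_symHessKerAt_le {L : ℕ} (hL : 1 ≤ L) (μ : Fin d) (y : Site d) {r : Fin d → ℕ} (hr : r ∈ box d L)
    (f f' : Bond d) : |symHessKerAt (toSite r) L μ y f f'| ≤ 2 * (ell d L : ℝ) ^ 2 := by
  have hfac : (0 : ℝ) < (d ! : ℝ) := by exact_mod_cast Nat.factorial_pos d
  have hden : (0 : ℝ) < 2 * (d ! : ℝ) ^ 2 * (L : ℝ) ^ d := by positivity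
  have h := abs_symHessCountAt_le hL μ y hr f f'
  have h' : (|symHessCountAt (toSite r) L μ y f f'| : ℝ) ≤ 4 * (d ! : ℝ) ^ 2 * (L : ℝ) ^ d * (ell d L : ℝ) ^ 2 := by exact_mod_cast h
  rw [symHessKerAt, abs_div, abs_of_pos hden, div_le_iff₀ hden]
  nlinarith

/-- [folklore] `|m^ρ_sym| ≤ 3ℓ²` (box root) — the SAME constant as the comb's `abs_vhKerAt_le`. -/
theorem abs_symVhKerAt_le {L : ℕ} (hL : 1 ≤ L) (μ : Fin d) (y : Site d) {r : Fin d → ℕ} (hr : r ∈ box d L)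
    (f f' : Bond d) : |symVhKerAt (toSite r) L μ y f f'| ≤ 3 * (ell d L : ℝ) ^ 2 := by
  have hfac : (0 : ℝ) < (d ! : ℝ) := by exact_mod_cast Nat.factorial_pos d
  have hden : (0 : ℝ) < 2 * (d ! : ℝ) ^ 2 * (L : ℝ) ^ (2 * d) := by positivity
  have h := abs_symVhCountAt_le hL μ y hr f f'
  have h' : (|symVhCountAt (toSite r) L μ y f f'| : ℝ) ≤ 6 * (d ! : ℝ) ^ 2 * (L : ℝ) ^ (2 * d) * (ell d L : ℝ) ^ 2 := by
    exact_mod_cast h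
  rw [symVhKerAt, abs_div, abs_of_pos hden, div_le_iff₀ hden]
  nlinarith

/-- [folklore] `|q¹,ρ_sym| ≤ ℓ` (box root). -/
theorem abs_symLinKerAt_le {L : ℕ} (hL : 1 ≤ L) (μ : Fin d) (y : Site d) {r : Fin d → ℕ} (hr : r ∈ box d L)
    (f : Bond d) : |symLinKerAt (toSite r) L μ y f| ≤ (ell d L : ℝ) := by
  have hfac : (0 : ℝ) < (d ! : ℝ) := by exact_mod_cast Nat.factorial_pos d
  have hden : (0 : ℝ) < (d ! : ℝ) * (L : ℝ) ^ d := by positivity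
  have h := abs_symLinCountAt_le hL μ y hr f
  have h' : (|symLinCountAt (toSite r) L μ y f| : ℝ) ≤ (d ! : ℝ) * ((L : ℝ) ^ d * (ell d L : ℝ)) := by exact_mod_cast h
  rw [symLinKerAt, abs_div, abs_of_pos hden, div_le_iff₀ hden]
  nlinarith

/-- [folklore] `δ_f` as a REAL one-form is the real delta force `(κ, x) ↦ [κ = f.1 ∧ x = f.2]` (the shape of `KKTFluctuationKernel.delta1 f.1 f.2`,
stated without importing it). -/
theorem mapForm_δ1_real (f : Bond d) :
    mapForm (Int.castAddHom ℝ) (δ1 f) = fun κ x => if κ = f.1 ∧ x = f.2 then (1 : ℝ) else 0 := by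
  funext κ x
  simp only [mapForm_apply, δ1_apply, Int.coe_castAddHom, Prod.ext_iff]
  split_ifs <;> simp

/-- [folklore] **BRIDGE TO THE (0.4) LINEAR KERNEL OF RECORD**: `q¹,ρ_sym(f) = (L^d)⁻¹·((d!)⁻¹·symLinAvgAt ρ (δ_f) L μ y)` — literally the body
of `DshAn1.lin04KerAt ρ L μ y f` (file `DshAn1Spread.lean`; dimension `d+1`, `delta1 f.1 f.2` unfolds to the lambda by `rfl` — an1 g41 probe
`ProbeLin04.lean`), so that in S2c `lin04KerAt = symLinKerAt` is `by rw [symLinKerAt_eq_symLinAvgAt]; rfl`. -/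
theorem symLinKerAt_eq_symLinAvgAt (ρ : Site d) (L : ℕ) (μ : Fin d) (y : Site d) (f : Bond d) :
    symLinKerAt ρ L μ y f
      = ((L : ℝ) ^ d)⁻¹ * (((d ! : ℝ))⁻¹ * symLinAvgAt ρ (fun κ x => if κ = f.1 ∧ x = f.2 then (1 : ℝ) else 0) L μ y) := by
  rw [symLinKerAt, symLinCountAt_real, mapForm_δ1_real, div_eq_inv_mul, mul_inv, mul_comm ((d ! : ℝ))⁻¹, mul_assoc]

end RealKernels

/-! ## §8 Packing with node 7a's `packVH`: the symmetrised stencil family `symVhSAt` ((LV)(TV)) and the `(inl,inl)`-block kernel `symHessFFAt` ((LH)(TH)) -/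

section Packing

open ExpKernelCalculus (MKer BiLoc shiftK VertexFamily)
open OneStepResolventKernel (Fib LocStencil)
open Literature.MathematicalPhysics.QuantumFieldTheory.Balaban1983to89.B12Sec2to5 (l1 l1_nonneg)

/-- [our object] **THE SYMMETRISED FIELD–MULTIPLIER STENCIL FAMILY, PRODUCT CHART** (sym twin of node 7aρ `vhSAt ρ`; the TYPE of the field `V`
of `SymmetrisedStepJets.SymTables`): node 7a's packer applied to `m_sym = symVhKerAt ρ`. -/
noncomputable def symVhSAt (ρ : Fin (d + 1) → ℤ) (d' L : ℕ) (_h : d' = d := by rfl) :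
    Fin (d + 1) → (Fin (d + 1) → ℤ) → MKer (d + 1) (Fib d) :=
  packVH (fun μ y f f' => symVhKerAt ρ L μ y f f') L

/-- [our object] **THE SYMMETRISED FIELD–MULTIPLIER STENCIL FAMILY, ADDITIVE CHART** (sym twin of `vhSaddAt ρ`): the packing of `h_sym`. -/
noncomputable def symVhSaddAt (ρ : Fin (d + 1) → ℤ) (d' L : ℕ) (_h : d' = d := by rfl) :
    Fin (d + 1) → (Fin (d + 1) → ℤ) → MKer (d + 1) (Fib d) :=
  packVH (fun μ y f f' => symHessKerAt ρ L μ y f f') L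

/-- [folklore] `symVhSAt` is symmetric. -/
theorem symVhSAt_symm (ρ : Fin (d + 1) → ℤ) (L : ℕ) (κ' : Fin (d + 1)) (u x z : Fin (d + 1) → ℤ) (a b : Fib d) :
    symVhSAt ρ d L rfl κ' u x z a b = symVhSAt ρ d L rfl κ' u z x b a := packVH_symm _ L κ' u x z a b

/-- [folklore] `symVhSaddAt` is symmetric. -/
theorem symVhSaddAt_symm (ρ : Fin (d + 1) → ℤ) (L : ℕ) (κ' : Fin (d + 1)) (u x z : Fin (d + 1) → ℤ) (a b : Fib d) :
    symVhSaddAt ρ d L rfl κ' u x z a b = symVhSaddAt ρ d L rfl κ' u z x b a := packVH_symm _ L κ' u x z a b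

/-- [folklore] **(LV) `symVhSAt` IS A LOCAL STENCIL FAMILY** (box root) for every `δ ≥ 0`, node 7a's constant `3ℓ² · e^{4(d+1)Lδ}`,
`ℓ = (2d+4)L`. -/
theorem locStencil_symVhSAt {L : ℕ} (hL : 1 ≤ L) {r : Fin (d + 1) → ℕ} (hr : r ∈ box (d + 1) L) {δ : ℝ} (hδ : 0 ≤ δ) :
    LocStencil (symVhSAt (toSite r) d L) (3 * (ell (d + 1) L : ℝ) ^ 2 * Real.exp (4 * ((d : ℝ) + 1) * L * δ)) δ :=
  locStencil_packVH _ hL (by positivity) (fun _ _ _ f' h => symVhKerAt_eq_zero_left hr h f')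
    (fun _ _ f _ h => symVhKerAt_eq_zero_right hr f h) (fun μ y f f' => abs_symVhKerAt_le hL μ y hr f f') hδ

/-- [folklore] **`symVhSaddAt` IS A LOCAL STENCIL FAMILY** (box root) for every `δ ≥ 0`, constant `2ℓ² · e^{4(d+1)Lδ}`. -/
theorem locStencil_symVhSaddAt {L : ℕ} (hL : 1 ≤ L) {r : Fin (d + 1) → ℕ} (hr : r ∈ box (d + 1) L) {δ : ℝ} (hδ : 0 ≤ δ) :
    LocStencil (symVhSaddAt (toSite r) d L) (2 * (ell (d + 1) L : ℝ) ^ 2 * Real.exp (4 * ((d : ℝ) + 1) * L * δ)) δ :=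
  locStencil_packVH _ hL (by positivity) (fun _ _ _ f' h => symHessKerAt_eq_zero_left hr h f')
    (fun _ _ f _ h => symHessKerAt_eq_zero_right hr f h) (fun μ y f f' => abs_symHessKerAt_le hL μ y hr f f') hδ

/-- [folklore] **(TV)** block-translation covariance of `symVhSAt` (all root offsets). -/
theorem symVhSAt_translate (ρ : Fin (d + 1) → ℤ) {L : ℕ} (hL : 1 ≤ L) (κ' : Fin (d + 1)) (u t : Fin (d + 1) → ℤ) :
    symVhSAt ρ d L rfl κ' (u + (L : ℤ) • t) = shiftK (-((L : ℤ) • t)) (symVhSAt ρ d L rfl κ' u) :=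
  packVH_translate _ hL (fun μ y t f f' => symVhKerAt_add ρ L μ y t f f') κ' u t

/-- [folklore] Block-translation covariance of `symVhSaddAt` (all root offsets). -/
theorem symVhSaddAt_translate (ρ : Fin (d + 1) → ℤ) {L : ℕ} (hL : 1 ≤ L) (κ' : Fin (d + 1)) (u t : Fin (d + 1) → ℤ) :
    symVhSaddAt ρ d L rfl κ' (u + (L : ℤ) • t) = shiftK (-((L : ℤ) • t)) (symVhSaddAt ρ d L rfl κ' u) :=
  packVH_translate _ hL (fun μ y t f f' => symHessKerAt_add ρ L μ y t f f') κ' u t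

/-- [folklore] **(LV) in the record's letter shape**: `∀ δ ≥ 0, ∃ C, LocStencil (symVhSAt ρ d L) C δ` (box root). -/
theorem symVhSAt_hV {L : ℕ} (hL : 1 ≤ L) {r : Fin (d + 1) → ℕ} (hr : r ∈ box (d + 1) L) :
    ∀ δ : ℝ, 0 ≤ δ → ∃ C : ℝ, LocStencil (symVhSAt (toSite r) d L) C δ := fun _ hδ => ⟨_, locStencil_symVhSAt hL hr hδ⟩

/-- [folklore] **(TV) in the record's letter shape** (needs `1 ≤ L`). -/
theorem symVhSAt_hVt (ρ : Fin (d + 1) → ℤ) {L : ℕ} (hL : 1 ≤ L) :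
    ∀ (κ : Fin (d + 1)) (u t : Fin (d + 1) → ℤ), symVhSAt ρ d L rfl κ (u + (L : ℤ) • t) = shiftK (-((L : ℤ) • t)) (symVhSAt ρ d L rfl κ u) :=
  fun κ u t => symVhSAt_translate ρ hL κ u t

/-! ### The symmetrised W-Hessian of the constraint per coarse bond, packed on the `(inl, inl)` block -/

/-- [our object] **THE SYMMETRISED W-HESSIAN KERNEL OF THE COARSE BOND `b = (μ, y)`** as an `MKer (d+1) (Fib d)` supported on the field–field
block (sym twin of node 7aρ `hessFFAt ρ`; the TYPE of the field `H` of `SymmetrisedStepJets.SymTables`): entry `((x, inl α), (x′, inl α′)) ↦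
h^ρ_sym((α, x), (α′, x′))`. -/
noncomputable def symHessFFAt (ρ : Fin (d + 1) → ℤ) (L : ℕ) (μ : Fin (d + 1)) (y : Fin (d + 1) → ℤ) :
    MKer (d + 1) (Fib d) := fun x x' a b =>
  match a, b with
  | Sum.inl α, Sum.inl α' => symHessKerAt ρ L μ y (α, x) (α', x')
  | _, _ => 0

/-- [folklore] The field–field entries of `symHessFFAt`. -/
@[simp] theorem symHessFFAt_inl_inl (ρ : Fin (d + 1) → ℤ) (L : ℕ) (μ : Fin (d + 1)) (y x x' : Fin (d + 1) → ℤ)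
    (α α' : Fin (d + 1)) : symHessFFAt ρ L μ y x x' (Sum.inl α) (Sum.inl α') = symHessKerAt ρ L μ y (α, x) (α', x') := rfl

/-- [folklore] `symHessFFAt` vanishes on `(inl, inr)`. -/
@[simp] theorem symHessFFAt_inl_inr (ρ : Fin (d + 1) → ℤ) (L : ℕ) (μ : Fin (d + 1)) (y x x' : Fin (d + 1) → ℤ)
    (α μ' : Fin (d + 1)) : symHessFFAt ρ L μ y x x' (Sum.inl α) (Sum.inr μ') = 0 := rfl

/-- [folklore] `symHessFFAt` vanishes on `(inr, ·)`. -/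
@[simp] theorem symHessFFAt_inr (ρ : Fin (d + 1) → ℤ) (L : ℕ) (μ : Fin (d + 1)) (y x x' : Fin (d + 1) → ℤ)
    (μ' : Fin (d + 1)) (b : Fib d) : symHessFFAt ρ L μ y x x' (Sum.inr μ') b = 0 := by cases b <;> rfl

/-- [folklore] `symHessFFAt` is ANTISYMMETRIC (the coefficient of a commutator). -/
theorem symHessFFAt_antisymm (ρ : Fin (d + 1) → ℤ) (L : ℕ) (μ : Fin (d + 1)) (y x x' : Fin (d + 1) → ℤ) (a b : Fib d) :
    symHessFFAt ρ L μ y x' x b a = -symHessFFAt ρ L μ y x x' a b := by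
  rcases a with α | ν <;> rcases b with α' | ν'
  · rw [symHessFFAt_inl_inl, symHessFFAt_inl_inl, symHessKerAt_swap]
  all_goals simp

/-- [folklore] **`symHessFFAt` IS BI-LOCALISED** (box root) at any CENTRE `c` of the support box, every `δ ≥ 0`, node 7a's constant
`2ℓ² · e^{4(d+1)Lδ}`. -/
theorem biLoc_symHessFFAt_of_near {L : ℕ} (hL : 1 ≤ L) (μ : Fin (d + 1)) (y : Fin (d + 1) → ℤ) {r : Fin (d + 1) → ℕ}
    (hr : r ∈ box (d + 1) L) {c : Fin (d + 1) → ℤ} (hc : Near L y c) {δ : ℝ} (hδ : 0 ≤ δ) :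
    BiLoc (symHessFFAt (toSite r) L μ y) c c (2 * (ell (d + 1) L : ℝ) ^ 2 * Real.exp (4 * ((d : ℝ) + 1) * L * δ)) δ := by
  intro x x' a b
  have hpos : 0 ≤ 2 * (ell (d + 1) L : ℝ) ^ 2 * Real.exp (4 * ((d : ℝ) + 1) * L * δ) *
      Real.exp (-δ * (l1 (x - c) + l1 (x' - c))) := by positivity
  rcases a with α | ν
  · rcases b with α' | ν'
    · rw [symHessFFAt_inl_inl]
      by_cases hx : Near L y x
      · by_cases hx' : Near L y x'
        · have d1 := l1_le_of_near hx hc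
          have d2 := l1_le_of_near hx' hc
          have hsum : δ * (l1 (x - c) + l1 (x' - c)) ≤ 4 * ((d : ℝ) + 1) * L * δ := by nlinarith
          have h1 : 1 ≤ Real.exp (4 * ((d : ℝ) + 1) * L * δ) * Real.exp (-δ * (l1 (x - c) + l1 (x' - c))) := by
            rw [← Real.exp_add]; exact Real.one_le_exp (by linarith)
          have hb := abs_symHessKerAt_le hL μ y hr (α, x) (α', x')
          calc |symHessKerAt (toSite r) L μ y (α, x) (α', x')| ≤ 2 * (ell (d + 1) L : ℝ) ^ 2 * 1 := by
                rw [mul_one]; exact hb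
            _ ≤ 2 * (ell (d + 1) L : ℝ) ^ 2 * (Real.exp (4 * ((d : ℝ) + 1) * L * δ) *
                  Real.exp (-δ * (l1 (x - c) + l1 (x' - c)))) := mul_le_mul_of_nonneg_left h1 (by positivity)
            _ = _ := by ring
        · rw [symHessKerAt_eq_zero_right hr _ hx', abs_zero]; exact hpos
      · rw [symHessKerAt_eq_zero_left hr hx, abs_zero]; exact hpos
    · rw [symHessFFAt_inl_inr, abs_zero]; exact hpos
  · rw [symHessFFAt_inr, abs_zero]; exact hpos

/-- [folklore] **`symHessFFAt` IS BI-LOCALISED AT THE COARSE BOND** (at `L·y`) for a box root and every `δ ≥ 0`. -/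
theorem biLoc_symHessFFAt {L : ℕ} (hL : 1 ≤ L) (μ : Fin (d + 1)) (y : Fin (d + 1) → ℤ) {r : Fin (d + 1) → ℕ}
    (hr : r ∈ box (d + 1) L) {δ : ℝ} (hδ : 0 ≤ δ) :
    BiLoc (symHessFFAt (toSite r) L μ y) ((L : ℤ) • y) ((L : ℤ) • y)
      (2 * (ell (d + 1) L : ℝ) ^ 2 * Real.exp (4 * ((d : ℝ) + 1) * L * δ)) δ :=
  biLoc_symHessFFAt_of_near hL μ y hr (near_self hL y) hδ

/-- [folklore] **`symHessFFAt` IS BI-LOCALISED AT THE FINE ROOT `L·y + ρ`** (box root) for every `δ ≥ 0`, same constant. -/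
theorem biLoc_symHessFFAt_root {L : ℕ} (hL : 1 ≤ L) (μ : Fin (d + 1)) (y : Fin (d + 1) → ℤ) {r : Fin (d + 1) → ℕ}
    (hr : r ∈ box (d + 1) L) {δ : ℝ} (hδ : 0 ≤ δ) :
    BiLoc (symHessFFAt (toSite r) L μ y) ((L : ℤ) • y + toSite r) ((L : ℤ) • y + toSite r)
      (2 * (ell (d + 1) L : ℝ) ^ 2 * Real.exp (4 * ((d : ℝ) + 1) * L * δ)) δ :=
  biLoc_symHessFFAt_of_near hL μ y hr (near_root hL y hr) hδ

/-- [folklore] **(LH) `symHessFFAt` IS A FIRST-ORDER VERTEX FAMILY** (box root) for every `δ ≥ 0` (an2's `ExpKernelCalculus.VertexFamily`, scale `L`). -/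
theorem vertexFamily_symHessFFAt {L : ℕ} (hL : 1 ≤ L) {r : Fin (d + 1) → ℕ} (hr : r ∈ box (d + 1) L) {δ : ℝ} (hδ : 0 ≤ δ) :
    VertexFamily (symHessFFAt (toSite r) L) L (2 * (ell (d + 1) L : ℝ) ^ 2 * Real.exp (4 * ((d : ℝ) + 1) * L * δ)) δ :=
  fun μ y => biLoc_symHessFFAt hL μ y hr hδ

/-- [folklore] **(TH)** block-translation covariance of `symHessFFAt` (all root offsets; node 7a's byte shape). -/
theorem symHessFFAt_translate (ρ : Fin (d + 1) → ℤ) {L : ℕ} (μ : Fin (d + 1)) (y t : Fin (d + 1) → ℤ) :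
    symHessFFAt ρ L μ (y + t) = shiftK (-((L : ℤ) • t)) (symHessFFAt ρ L μ y) := by
  funext x x' a b
  simp only [shiftK]
  rcases a with α | ν
  · rcases b with α' | ν'
    · rw [symHessFFAt_inl_inl, symHessFFAt_inl_inl]
      have := symHessKerAt_add ρ L μ y t (α, x + -((L : ℤ) • t)) (α', x' + -((L : ℤ) • t))
      rw [← this]
      congr 1 <;> simp [Bond.sh]
    · rfl
  · cases b <;> rfl

/-- [folklore] **(LH) in the record's letter shape**: `∀ δ ≥ 0, ∃ C, VertexFamily (symHessFFAt ρ L) L C δ` (box root). -/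
theorem symHessFFAt_hH {L : ℕ} (hL : 1 ≤ L) {r : Fin (d + 1) → ℕ} (hr : r ∈ box (d + 1) L) :
    ∀ δ : ℝ, 0 ≤ δ → ∃ C : ℝ, VertexFamily (symHessFFAt (toSite r) L) L C δ := fun _ hδ => ⟨_, vertexFamily_symHessFFAt hL hr hδ⟩

/-- [folklore] **(TH) in the record's letter shape**. -/
theorem symHessFFAt_hHt (ρ : Fin (d + 1) → ℤ) (L : ℕ) :
    ∀ (μ : Fin (d + 1)) (y t : Fin (d + 1) → ℤ), symHessFFAt ρ L μ (y + t) = shiftK (-((L : ℤ) • t)) (symHessFFAt ρ L μ y) :=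
  fun μ y t => symHessFFAt_translate ρ μ y t

/-! ### The centred root `ρ_c = ctr (d+1) L = toSite (ctrOff (d+1) L)` (node 5ρ; the root of an1's instance): the four letters with NO
root hypothesis left (only `1 ≤ L`). -/

/-- [folklore] **(LV) at the centred root**, letter shape of `SymTables.hV`. -/
theorem symVhSAt_hV_ctr {L : ℕ} (hL : 1 ≤ L) :
    ∀ δ : ℝ, 0 ≤ δ → ∃ C : ℝ, LocStencil (symVhSAt (ctr (d + 1) L) d L) C δ := symVhSAt_hV hL (ctrOff_mem_box hL)

/-- [folklore] **(LH) at the centred root**, letter shape of `SymTables.hH`. -/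
theorem symHessFFAt_hH_ctr {L : ℕ} (hL : 1 ≤ L) :
    ∀ δ : ℝ, 0 ≤ δ → ∃ C : ℝ, VertexFamily (symHessFFAt (ctr (d + 1) L) L) L C δ := symHessFFAt_hH hL (ctrOff_mem_box hL)

/-- [folklore] **(TV) at the centred root**, letter shape of `SymTables.hVt`. -/
theorem symVhSAt_hVt_ctr {L : ℕ} (hL : 1 ≤ L) :
    ∀ (κ : Fin (d + 1)) (u t : Fin (d + 1) → ℤ),
      symVhSAt (ctr (d + 1) L) d L rfl κ (u + (L : ℤ) • t) = shiftK (-((L : ℤ) • t)) (symVhSAt (ctr (d + 1) L) d L rfl κ u) :=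
  symVhSAt_hVt _ hL

/-- [folklore] **(TH) at the centred root**, letter shape of `SymTables.hHt`. -/
theorem symHessFFAt_hHt_ctr (L : ℕ) :
    ∀ (μ : Fin (d + 1)) (y t : Fin (d + 1) → ℤ),
      symHessFFAt (ctr (d + 1) L) L μ (y + t) = shiftK (-((L : ℤ) • t)) (symHessFFAt (ctr (d + 1) L) L μ y) :=
  symHessFFAt_hHt _ L

/-- [folklore] `symVhSAt` has no field–field block (node 7a's packer puts `m` on the field–multiplier blocks only). -/
@[simp] theorem symVhSAt_inl_inl (ρ : Fin (d + 1) → ℤ) (L : ℕ) (κ' : Fin (d + 1)) (u x z : Fin (d + 1) → ℤ) (β β' : Fin (d + 1)) :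
    symVhSAt ρ d L rfl κ' u x z (Sum.inl β) (Sum.inl β') = 0 := rfl

/-- [folklore] **(V-ff0) — the letter `hV0` of the root END `DshAn1End.d1Drift_JsB12Sym_of_an1Shift_reflLetters_D1Tel_D1Rep` for the
instance `V := symVhSAt ρ_c d L`**, in its exact binder shape (`d = 3` there): a THEOREM, by `rfl`. -/
theorem symVhSAt_hV0_ctr (L : ℕ) :
    ∀ (κ : Fin (d + 1)) (w x z : Fin (d + 1) → ℤ) (β β' : Fin (d + 1)), symVhSAt (ctr (d + 1) L) d L rfl κ w x z (Sum.inl β) (Sum.inl β') = 0 :=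
  fun _ _ _ _ _ _ => rfl

/-! ### Scalar multiples of `symHessFFAt` — the letters (LM)(TM) of a multiplier table `M j := c_j • symHessFFAt ρ_c L`
(sym twin of `SpineRootedW2.M1At`, whose weight is `c_j = cΛ·wM1 j`; the weight is the owner's and is left GENERIC here). -/

/-- [folklore] A scalar multiple of a bi-localised kernel is bi-localised, constant `|c|·C` (node `StepJetData.biLoc_smul`, re-proved
here to keep this module's imports at two). -/
theorem biLoc_smul_ff {K : MKer (d + 1) (Fib d)} {p q : Fin (d + 1) → ℤ} {C δ : ℝ} (h : BiLoc K p q C δ) (c : ℝ) :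
    BiLoc (c • K) p q (|c| * C) δ := by
  intro x y a b
  simp only [Pi.smul_apply, smul_eq_mul, abs_mul, mul_assoc]
  exact mul_le_mul_of_nonneg_left (h x y a b) (abs_nonneg c)

/-- [folklore] **(LM) for `c • symHessFFAt`** (box root), every `δ ≥ 0`. -/
theorem vertexFamily_smul_symHessFFAt {L : ℕ} (hL : 1 ≤ L) {r : Fin (d + 1) → ℕ} (hr : r ∈ box (d + 1) L) (c : ℝ) {δ : ℝ}
    (hδ : 0 ≤ δ) :
    VertexFamily (fun μ w => c • symHessFFAt (toSite r) L μ w) L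
      (|c| * (2 * (ell (d + 1) L : ℝ) ^ 2 * Real.exp (4 * ((d : ℝ) + 1) * L * δ))) δ :=
  fun μ w => biLoc_smul_ff (biLoc_symHessFFAt hL μ w hr hδ) c

/-- [folklore] **(TM) for `c • symHessFFAt`** (all roots). -/
theorem smul_symHessFFAt_translate (ρ : Fin (d + 1) → ℤ) (L : ℕ) (c : ℝ) (μ : Fin (d + 1)) (w t : Fin (d + 1) → ℤ) :
    c • symHessFFAt ρ L μ (w + t) = shiftK (-((L : ℤ) • t)) (c • symHessFFAt ρ L μ w) := by
  funext x z a b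
  rw [symHessFFAt_translate ρ μ w t]
  simp only [Pi.smul_apply, shiftK]

/-- [folklore] **(LM) at the centred root in the letter shape of `SymTables.hM`** for `M j := c j • symHessFFAt ρ_c L` (rate `δ = 1`). -/
theorem smul_symHessFFAt_hM_ctr {L : ℕ} (hL : 1 ≤ L) (c : ℕ → ℝ) :
    ∀ j : ℕ, ∃ CM δ : ℝ, 0 < δ ∧ VertexFamily (fun μ w => c j • symHessFFAt (ctr (d + 1) L) L μ w) L CM δ :=
  fun j => ⟨_, 1, one_pos, vertexFamily_smul_symHessFFAt hL (ctrOff_mem_box hL) (c j) zero_le_one⟩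

/-- [folklore] **(TM) at the centred root in the letter shape of `SymTables.hMt`** for `M j := c j • symHessFFAt ρ_c L`. -/
theorem smul_symHessFFAt_hMt_ctr (L : ℕ) (c : ℕ → ℝ) :
    ∀ (j : ℕ) (μ : Fin (d + 1)) (w t : Fin (d + 1) → ℤ),
      c j • symHessFFAt (ctr (d + 1) L) L μ (w + t) = shiftK (-((L : ℤ) • t)) (c j • symHessFFAt (ctr (d + 1) L) L μ w) :=
  fun j μ w t => smul_symHessFFAt_translate _ L (c j) μ w t

end Packing

/-! ## §9 Decided toy entries (`d = 1`, `L = 3`, centred root `ρ = 1`): with ONE axial order the symmetrised tables ARE node 7aρ's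
comb tables (`1! = 1`, `S_1 = {1}`) — the same decided numbers as node 7aρ §10 (`LIN = 3` on `c₁,c₂,c₃`, `HESS(c₁,c₂) = 3`,
`VH(c₂,c₁) = −18`).  The `d ≥ 2` tables (where the symmetrisation is NOT trivial) are tabulated by the engine of record
`symassemble2.py` (an1 gen 33, sha16 43f3ae929be7fe20; dictionary in the module docstring) and are not decided here. -/

section Toy

example : symLinCountAt (fun _ => 1) 3 (0 : Fin 1) (fun _ => 0) (0, fun _ => 0) = 0 := by decide
example : symLinCountAt (fun _ => 1) 3 (0 : Fin 1) (fun _ => 0) (0, fun _ => 1) = 3 := by decide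
example : symLinCountAt (fun _ => 1) 3 (0 : Fin 1) (fun _ => 0) (0, fun _ => 3) = 3 := by decide
example : symLinCountAt (fun _ => 1) 3 (0 : Fin 1) (fun _ => 0) (0, fun _ => 4) = 0 := by decide

example : symHessCountAt (fun _ => 1) 3 (0 : Fin 1) (fun _ => 0) (0, fun _ => 1) (0, fun _ => 2) = 3 := by decide
example : symHessCountAt (fun _ => 1) 3 (0 : Fin 1) (fun _ => 0) (0, fun _ => 2) (0, fun _ => 1) = -3 := by decide
example : symHessCountAt (fun _ => 1) 3 (0 : Fin 1) (fun _ => 0) (0, fun _ => 0) (0, fun _ => 1) = 0 := by decide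

example : symVhCountAt (fun _ => 1) 3 (0 : Fin 1) (fun _ => 0) (0, fun _ => 2) (0, fun _ => 1) = -18 := by decide
example : symVhCountAt (fun _ => 1) 3 (0 : Fin 1) (fun _ => 0) (0, fun _ => 1) (0, fun _ => 2) = 0 := by decide
example : symVhCountAt (fun _ => 1) 3 (0 : Fin 1) (fun _ => 0) (0, fun _ => 1) (0, fun _ => 1) = 0 := by decide

end Toy

end Summit.QuantumFields.BalabanUV.Beta.SymAveragingHessianCounts
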